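import Summits.QuantumFields.YangMills.Theorems.BalabanLadderIRTwistedSlabHodgeDeterminant
import Literature.Analysis.Matrix.TwistedCycleLaplacian
import HarnessLib

/-!
# Colour-momentum modes of the covariant Laplacian at a twist-eating ladder: the intertwiner with lit-4's
# twisted torus Laplacian (K31b of the T1-box programme)

HELPER toward stub **T1** `TwistedSlabAnchor` of LINE `twisted-slab-continuity` (crux `IRcof`, stmt-QuantumFields-26930, census
row 43; LEAD prover ym-ir-line-tsc-p1 g5; `--supports` the crux, `--as helper`).  Theorems only.

For a unitary link field `U` on the `Fin` box and a colour matrix `Γ` on which every link acts by a PHASE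
(`U(y,μ) Γ U(y,μ)ᴴ = c_μ(y)·Γ` — at the twist-eating ladder `![A, B, c₂·1, c₃·1]` this holds for each of 't Hooft's
momentum matrices `Γ_p = A^a B^b` with `c₀ = ω^b` resp. `c₁ = ω^{−a}` on the sheet `y_μ = 0` and `1` elsewhere, lit-4 L32
`TwistEaterColourMomentumBasis`), and a GAUGE FACTOR `g` spreading the sheet phase uniformly
(`c_μ(y)·g(y + e_μ) = ζ_μ·g(y)`), the complex covariant Laplacian `Δ = Σ_μ (S_μ† − 1)(S_μ − 1)` of K8
(`DiscreteWeitzenboeck.covLaplacian (covDerivₗ U) (covDerivAdjₗ U)`) satisfies the INTERTWINING IDENTITY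
`Δ (φ·g ⊗ Γ) = ((Δ_ζ φ)·g) ⊗ Γ` with lit-4's scalar `twistedTorusLaplacian n₀ n₁ n₂ n₃ ζ` (L29): §1 `covLaplacian_apply_eq`
(`Δ Φ = Σ_μ (2Φ − S_μΦ − S_μ†Φ)`), ★ `covLaplacian_colourMode`.  §2 supplies the gauge factor for the ladder
(`ladderGauge`-type identities `gaugeFactor_shift`) and the phases of the ladder links on `Γ_p` (`ladder_conj_mode`,
`ladder_conjTranspose_mode`).  The determinant bookkeeping (L30 real form, L31 blocks, L29 closed form) follows in K31c.

HONEST FRAMING: finite-dimensional linear algebra at one box; nothing uniform in `β`, `L`; T1 0∕1; nothing here bears on `IRcof`,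
`IR`, or the Yang–Mills mass gap (Clay: NOT proved); R4 = `BalabanLadder.UV` only.
References: M. García Pérez, A. González-Arroyo, M. Okawa, JHEP 10 (2017) 150 §2.3–§2.5; IJMPA 29 (2014) 1445001 §2–§3.
-/

set_option autoImplicit false

noncomputable section

open scoped Matrix BigOperators
open Finset
open Literature.MathematicalPhysics.QuantumFieldTheory Literature.MathematicalPhysics.QuantumLattice
open Literature.Analysis.OperatorTheory
open Literature.Analysis.Matrix.TwistedCycleLaplacian (twistedTorusLaplacian twistedTorusLaplacian_mulVec_apply)

namespace Summit.QuantumFields.YangMills.Cruxes.IRcof.TwistedSlab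

variable {N : ℕ} {n₀ n₁ n₂ n₃ : ℕ}

/-! ## §1 The covariant Laplacian on a colour mode: the intertwiner -/

section Intertwiner

variable {U : FinTorusSite n₀ n₁ n₂ n₃ × Fin 4 → Matrix (Fin N) (Fin N) ℂ}

/-- **`Δ Φ = Σ_μ (2Φ − S_μ Φ − S_μ† Φ)`** for a unitary background (`S_μ† S_μ = 1`): the complex covariant Laplacian of K8 as a
nearest-neighbour stencil. [cite: GarciaperezGonzalezarroyoOkawa2017, §2.3–§2.5] -/
theorem covLaplacian_apply_eq (hU : ∀ e, U e ∈ Matrix.unitaryGroup (Fin N) ℂ)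
    (Φ : FinTorusSite n₀ n₁ n₂ n₃ → Matrix (Fin N) (Fin N) ℂ) (y : FinTorusSite n₀ n₁ n₂ n₃) :
    DiscreteWeitzenboeck.covLaplacian (covDerivₗ U) (covDerivAdjₗ U) Φ y = ∑ μ : Fin 4, ((2 : ℂ) • Φ y - covShift U μ Φ y - covShiftAdj U μ Φ y) := by
  rw [DiscreteWeitzenboeck.covLaplacian_apply, Finset.sum_apply]
  refine Finset.sum_congr rfl fun μ _ => ?_
  rw [covDerivAdjₗ_apply, covDerivₗ_apply]
  have h1 : covDeriv U μ Φ = fun x => covShift U μ Φ x - Φ x := rfl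
  simp only [h1, covShiftAdj_sub, covShiftAdj_covShift hU, two_smul]
  abel

variable [NeZero n₀] [NeZero n₁] [NeZero n₂] [NeZero n₃]

/-- The four forward shifts in coordinates (`finRotate = (· + 1)`). [folklore] -/
theorem shift_eq (y : FinTorusSite n₀ n₁ n₂ n₃) :
    y.shift 0 = (y.1 + 1, y.2) ∧ y.shift 1 = (y.1, y.2.1 + 1, y.2.2) ∧
      y.shift 2 = (y.1, y.2.1, y.2.2.1 + 1, y.2.2.2) ∧ y.shift 3 = (y.1, y.2.1, y.2.2.1, y.2.2.2 + 1) := by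
  obtain ⟨a, b, c, d⟩ := y
  refine ⟨?_, ?_, ?_, ?_⟩ <;>
    simp [FinTorusSite.shift, Matrix.cons_val_zero, Matrix.cons_val_one, Matrix.cons_val, finRotate_apply]

/-- The four backward shifts in coordinates (`finRotate⁻¹ = (· − 1)`). [folklore] -/
theorem siteUnshift_eq (y : FinTorusSite n₀ n₁ n₂ n₃) :
    siteUnshift y 0 = (y.1 - 1, y.2) ∧ siteUnshift y 1 = (y.1, y.2.1 - 1, y.2.2) ∧
      siteUnshift y 2 = (y.1, y.2.1, y.2.2.1 - 1, y.2.2.2) ∧ siteUnshift y 3 = (y.1, y.2.1, y.2.2.1, y.2.2.2 - 1) := by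
  obtain ⟨a, b, c, d⟩ := y
  refine ⟨?_, ?_, ?_, ?_⟩ <;>
    simp [siteUnshift, Matrix.cons_val_zero, Matrix.cons_val_one, Matrix.cons_val, finRotate_symm_apply]

/-- ★ **THE INTERTWINER.**  Let every link act on the colour matrix `Γ` by a non-zero phase, `U(y,μ) Γ U(y,μ)ᴴ = c_μ(y)·Γ` and
`U(y,μ)ᴴ Γ U(y,μ) = c_μ(y)⁻¹·Γ`, and let `g` be a gauge factor with `c_μ(y)·g(y + e_μ) = ζ_μ·g(y)` (`ζ_μ ≠ 0`).  Then for every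
scalar field `φ`: `Δ (y ↦ (φ(y) g(y))·Γ) = (y ↦ ((Δ_ζ φ)(y) g(y))·Γ)` with lit-4's `Δ_ζ = twistedTorusLaplacian n₀ n₁ n₂ n₃ ζ` —
the colour mode `Γ`, dressed by `g`, carries the SCALAR twisted Laplacian with UNIFORM phases `ζ`.
[cite: GarciaperezGonzalezarroyoOkawa2017, §2.3 (`Γ_μ χ Γ_μ† = e^{iL_μ q_μ} χ`) and §2.5] -/
theorem covLaplacian_colourMode (hU : ∀ e, U e ∈ Matrix.unitaryGroup (Fin N) ℂ) {Γ : Matrix (Fin N) (Fin N) ℂ}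
    {c : Fin 4 → FinTorusSite n₀ n₁ n₂ n₃ → ℂ} (hcne : ∀ μ y, c μ y ≠ 0) (hc : ∀ μ y, U (y, μ) * Γ * (U (y, μ))ᴴ = c μ y • Γ)
    (hc' : ∀ μ y, (U (y, μ))ᴴ * Γ * U (y, μ) = (c μ y)⁻¹ • Γ) {g : FinTorusSite n₀ n₁ n₂ n₃ → ℂ} {ζ : Fin 4 → ℂ}
    (hζ : ∀ μ, ζ μ ≠ 0) (hG : ∀ μ y, c μ y * g (y.shift μ) = ζ μ * g y) (φ : FinTorusSite n₀ n₁ n₂ n₃ → ℂ) :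
    DiscreteWeitzenboeck.covLaplacian (covDerivₗ U) (covDerivAdjₗ U) (fun y => (φ y * g y) • Γ) =
      fun y => ((twistedTorusLaplacian n₀ n₁ n₂ n₃ ζ).mulVec φ y * g y) • Γ := by
  funext y
  rw [covLaplacian_apply_eq hU]
  -- the shifted terms, direction by direction
  have hS : ∀ μ, covShift U μ (fun y => (φ y * g y) • Γ) y = (ζ μ * φ (y.shift μ) * g y) • Γ := fun μ => by
    rw [covShift_apply, Matrix.mul_smul, Matrix.smul_mul, hc, smul_smul]
    congr 1
    linear_combination (φ (y.shift μ)) * hG μ y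
  have hS' : ∀ μ, covShiftAdj U μ (fun y => (φ y * g y) • Γ) y = ((ζ μ)⁻¹ * φ (siteUnshift y μ) * g y) • Γ := fun μ => by
    simp only [covShiftAdj, Matrix.mul_smul, Matrix.smul_mul, hc']
    rw [smul_smul]
    congr 1
    have h := hG μ (siteUnshift y μ)
    rw [shift_siteUnshift] at h
    have hcμ := hcne μ (siteUnshift y μ)
    have hζμ := hζ μ
    field_simp
    linear_combination (-φ (siteUnshift y μ)) * h
  simp only [hS, hS', smul_smul, ← sub_smul]
  rw [← Finset.sum_smul]
  congr 1
  obtain ⟨h0, h1, h2, h3⟩ := shift_eq y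
  obtain ⟨u0, u1, u2, u3⟩ := siteUnshift_eq y
  rw [twistedTorusLaplacian_mulVec_apply, Fin.sum_univ_four, h0, h1, h2, h3, u0, u1, u2, u3]
  ring

end Intertwiner

/-! ## §2 The twist-eating ladder: link phases on a colour mode and the gauge factor spreading them -/

section Ladder

/-- Unitary conjugation by a phase-eigenmatrix, inverted: `V Γ Vᴴ = c·Γ`, `c ≠ 0`, `V` unitary ⇒ `Vᴴ Γ V = c⁻¹·Γ`. [folklore] -/
theorem conjTranspose_mul_mul_eq_inv_smul {V Γ : Matrix (Fin N) (Fin N) ℂ} (hV : V ∈ Matrix.unitaryGroup (Fin N) ℂ) {c : ℂ}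
    (hc : c ≠ 0) (h : V * Γ * Vᴴ = c • Γ) : Vᴴ * Γ * V = c⁻¹ • Γ := by
  have h1 : Vᴴ * V = 1 := hV.1
  have h2 : Vᴴ * (V * Γ * Vᴴ) * V = Γ := by
    calc Vᴴ * (V * Γ * Vᴴ) * V = (Vᴴ * V) * Γ * (Vᴴ * V) := by simp only [Matrix.mul_assoc]
      _ = Γ := by rw [h1, Matrix.one_mul, Matrix.mul_one]
  rw [h, Matrix.mul_smul, Matrix.smul_mul] at h2
  calc Vᴴ * Γ * V = c⁻¹ • (c • (Vᴴ * Γ * V)) := by rw [smul_smul, inv_mul_cancel₀ hc, one_smul]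
    _ = c⁻¹ • Γ := by rw [h2]

/-- A central (scalar unitary) link does not see colour: `(c·1) Γ (c·1)ᴴ = Γ` for `conj(c)·c = 1`. [folklore] -/
theorem smul_one_mul_mul_conjTranspose {c : ℂ} (hc : star c * c = 1) (Γ : Matrix (Fin N) (Fin N) ℂ) :
    (c • (1 : Matrix (Fin N) (Fin N) ℂ)) * Γ * (c • (1 : Matrix (Fin N) (Fin N) ℂ))ᴴ = Γ := by
  rw [Matrix.conjTranspose_smul, Matrix.conjTranspose_one, Matrix.smul_mul, Matrix.one_mul, Matrix.mul_smul, Matrix.mul_one,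
    smul_smul, hc, one_smul]

/-- **Link phases of the decorated ladder `![A, B, c₂·1, c₃·1]` on a colour mode**: if `A Γ Aᴴ = α·Γ` and `B Γ Bᴴ = β·Γ` (for 't Hooft's
momentum matrices `Γ = A^aB^b`: `α = ω^b`, `β = ω^{−a}`, lit-4 L32), then the link `U(y, μ)` acts on `Γ` by the phase `α` resp. `β` on the
sheet `y_μ = 0` of direction `0` resp. `1`, and trivially elsewhere. [cite: GarciaperezGonzalezarroyoOkawa2017, §2.3] -/
theorem ladder_conj_mode {A B Γ : Matrix (Fin N) (Fin N) ℂ} {α β c₂ c₃ : ℂ} (hA : A * Γ * Aᴴ = α • Γ) (hB : B * Γ * Bᴴ = β • Γ)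
    (hc₂ : star c₂ * c₂ = 1) (hc₃ : star c₃ * c₃ = 1) (μ : Fin 4) (y : FinTorusSite n₀ n₁ n₂ n₃) :
    ladderField ![A, B, c₂ • (1 : Matrix (Fin N) (Fin N) ℂ), c₃ • (1 : Matrix (Fin N) (Fin N) ℂ)] (y, μ) * Γ *
        (ladderField ![A, B, c₂ • (1 : Matrix (Fin N) (Fin N) ℂ), c₃ • (1 : Matrix (Fin N) (Fin N) ℂ)] (y, μ))ᴴ =
      (if finTorusSiteCoord y μ = 0 then (![α, β, 1, 1] : Fin 4 → ℂ) μ else 1) • Γ := by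
  rw [ladderField_apply]
  split_ifs with h
  · fin_cases μ
    · simpa using hA
    · simpa using hB
    · simpa using smul_one_mul_mul_conjTranspose hc₂ Γ
    · simpa using smul_one_mul_mul_conjTranspose hc₃ Γ
  · rw [Matrix.conjTranspose_one, Matrix.one_mul, Matrix.mul_one, one_smul]

/-- **One gauge step along a twisted cycle**: with `ζ ^ n = α`, `(α if a = 0 else 1) · ζ^{a} = ζ · ζ^{(a − 1) mod n}` — the sheet
phase `α` at `a = 0` is the product of `n` uniform link phases `ζ`. [cite: GarciaperezGonzalezarroyoOkawa2017, §2.3] -/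
theorem gauge_step {n : ℕ} [NeZero n] {ζ α : ℂ} (hζ : ζ ^ n = α) (a : Fin n) :
    (if (a : ℕ) = 0 then α else 1) * ζ ^ (a : ℕ) = ζ * ζ ^ ((a - 1 : Fin n) : ℕ) := by
  obtain ⟨m, rfl⟩ : ∃ m, n = m + 1 := ⟨n - 1, (Nat.succ_pred_eq_of_ne_zero (NeZero.ne n)).symm⟩
  rw [Fin.coe_sub_one]
  by_cases ha : a = 0
  · subst ha
    simp only [Fin.val_zero, if_true, pow_zero, mul_one]
    rw [← hζ, pow_succ']
  · have ha' : (a : ℕ) ≠ 0 := fun h => ha (Fin.ext h)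
    rw [if_neg ha', if_neg ha, one_mul, ← pow_succ', Nat.sub_add_cancel (Nat.pos_of_ne_zero ha')]

variable [NeZero n₀] [NeZero n₁] [NeZero n₂] [NeZero n₃]

/-- **The gauge factor of the ladder**: `g(y) = ζ₀^{(y₀−1) mod n₀} ζ₁^{(y₁−1) mod n₁}` with `ζ₀^{n₀} = α`, `ζ₁^{n₁} = β` spreads the two
sheet phases into uniform link phases: `c_μ(y)·g(y + e_μ) = ζ_μ·g(y)`, `ζ = ![ζ₀, ζ₁, 1, 1]`. [cite: GarciaperezGonzalezarroyoOkawa2017, §2.3] -/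
theorem ladder_gauge_shift {ζ₀ ζ₁ α β : ℂ} (h₀ : ζ₀ ^ n₀ = α) (h₁ : ζ₁ ^ n₁ = β) (μ : Fin 4) (y : FinTorusSite n₀ n₁ n₂ n₃) :
    (if finTorusSiteCoord y μ = 0 then (![α, β, 1, 1] : Fin 4 → ℂ) μ else 1) *
        (ζ₀ ^ (((y.shift μ).1 - 1 : Fin n₀) : ℕ) * ζ₁ ^ (((y.shift μ).2.1 - 1 : Fin n₁) : ℕ)) =
      (![ζ₀, ζ₁, 1, 1] : Fin 4 → ℂ) μ * (ζ₀ ^ ((y.1 - 1 : Fin n₀) : ℕ) * ζ₁ ^ ((y.2.1 - 1 : Fin n₁) : ℕ)) := by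
  obtain ⟨e0, e1, e2, e3⟩ := shift_eq y
  fin_cases μ
  · simp only [Fin.zero_eta, Matrix.cons_val_zero, e0, add_sub_cancel_right]
    have h := gauge_step h₀ y.1
    simp only [finTorusSiteCoord, Matrix.cons_val_zero]
    rcases eq_or_ne (y.1 : ℕ) 0 with hy | hy
    · rw [if_pos hy] at h ⊢
      linear_combination (ζ₁ ^ ((y.2.1 - 1 : Fin n₁) : ℕ)) * h
    · rw [if_neg hy] at h ⊢
      linear_combination (ζ₁ ^ ((y.2.1 - 1 : Fin n₁) : ℕ)) * h
  · simp only [Fin.mk_one, Matrix.cons_val_one, Matrix.cons_val_zero, e1, add_sub_cancel_right]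
    have h := gauge_step h₁ y.2.1
    simp only [finTorusSiteCoord, Matrix.cons_val_one, Matrix.cons_val_zero]
    rcases eq_or_ne (y.2.1 : ℕ) 0 with hy | hy
    · rw [if_pos hy] at h ⊢
      linear_combination (ζ₀ ^ ((y.1 - 1 : Fin n₀) : ℕ)) * h
    · rw [if_neg hy] at h ⊢
      linear_combination (ζ₀ ^ ((y.1 - 1 : Fin n₀) : ℕ)) * h
  · simp [finTorusSiteCoord, e2]
  · simp [finTorusSiteCoord, e3]

variable {U : FinTorusSite n₀ n₁ n₂ n₃ × Fin 4 → Matrix (Fin N) (Fin N) ℂ}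

/-- ★★ **The covariant Laplacian at the decorated twist-eating ladder, on a dressed colour mode, IS lit-4's twisted torus Laplacian
with uniform phases `![ζ₀, ζ₁, 1, 1]`** (`ζ₀^{n₀} = α`, `ζ₁^{n₁} = β`, `A Γ Aᴴ = αΓ`, `B Γ Bᴴ = βΓ`, `α, β ≠ 0`, `A, B` unitary, central
decorations): `Δ (φ·g ⊗ Γ) = ((Δ_ζ φ)·g) ⊗ Γ`. [cite: GarciaperezGonzalezarroyoOkawa2017, §2.3–§2.5] -/
theorem covLaplacian_ladder_colourMode {A B Γ : Matrix (Fin N) (Fin N) ℂ} {α β c₂ c₃ ζ₀ ζ₁ : ℂ} (hα : α ≠ 0) (hβ : β ≠ 0) (hA : A * Γ * Aᴴ = α • Γ)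
    (hB : B * Γ * Bᴴ = β • Γ) (hc₂ : star c₂ * c₂ = 1) (hc₃ : star c₃ * c₃ = 1) (h₀ : ζ₀ ^ n₀ = α) (h₁ : ζ₁ ^ n₁ = β)
    (hU : ∀ e, ladderField (n₀ := n₀) (n₁ := n₁) (n₂ := n₂) (n₃ := n₃)
      ![A, B, c₂ • (1 : Matrix (Fin N) (Fin N) ℂ), c₃ • (1 : Matrix (Fin N) (Fin N) ℂ)] e ∈ Matrix.unitaryGroup (Fin N) ℂ)
    (φ : FinTorusSite n₀ n₁ n₂ n₃ → ℂ) :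
    DiscreteWeitzenboeck.covLaplacian
        (covDerivₗ (ladderField ![A, B, c₂ • (1 : Matrix (Fin N) (Fin N) ℂ), c₃ • (1 : Matrix (Fin N) (Fin N) ℂ)]))
        (covDerivAdjₗ (ladderField ![A, B, c₂ • (1 : Matrix (Fin N) (Fin N) ℂ), c₃ • (1 : Matrix (Fin N) (Fin N) ℂ)]))
        (fun y => (φ y * (ζ₀ ^ ((y.1 - 1 : Fin n₀) : ℕ) * ζ₁ ^ ((y.2.1 - 1 : Fin n₁) : ℕ))) • Γ) =
      fun y => ((twistedTorusLaplacian n₀ n₁ n₂ n₃ ![ζ₀, ζ₁, 1, 1]).mulVec φ y *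
        (ζ₀ ^ ((y.1 - 1 : Fin n₀) : ℕ) * ζ₁ ^ ((y.2.1 - 1 : Fin n₁) : ℕ))) • Γ := by
  have hζ₀ : ζ₀ ≠ 0 := fun h => hα (by rw [← h₀, h, zero_pow (NeZero.ne n₀)])
  have hζ₁ : ζ₁ ≠ 0 := fun h => hβ (by rw [← h₁, h, zero_pow (NeZero.ne n₁)])
  have hcne : ∀ (μ : Fin 4) (y : FinTorusSite n₀ n₁ n₂ n₃),
      (if finTorusSiteCoord y μ = 0 then (![α, β, 1, 1] : Fin 4 → ℂ) μ else 1) ≠ 0 := by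
    intro μ y
    split_ifs
    · fin_cases μ <;> simp [hα, hβ]
    · exact one_ne_zero
  have hc := fun μ y => ladder_conj_mode (n₀ := n₀) (n₁ := n₁) (n₂ := n₂) (n₃ := n₃) hA hB hc₂ hc₃ μ y
  have hc' : ∀ (μ : Fin 4) (y : FinTorusSite n₀ n₁ n₂ n₃),
      (ladderField ![A, B, c₂ • (1 : Matrix (Fin N) (Fin N) ℂ), c₃ • (1 : Matrix (Fin N) (Fin N) ℂ)] (y, μ))ᴴ * Γ *
        ladderField ![A, B, c₂ • (1 : Matrix (Fin N) (Fin N) ℂ), c₃ • (1 : Matrix (Fin N) (Fin N) ℂ)] (y, μ) =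
      (if finTorusSiteCoord y μ = 0 then (![α, β, 1, 1] : Fin 4 → ℂ) μ else 1)⁻¹ • Γ :=
    fun μ y => conjTranspose_mul_mul_eq_inv_smul (hU (y, μ)) (hcne μ y) (hc μ y)
  have hζ : ∀ μ : Fin 4, (![ζ₀, ζ₁, 1, 1] : Fin 4 → ℂ) μ ≠ 0 := by
    intro μ; fin_cases μ <;> simp [hζ₀, hζ₁]
  exact covLaplacian_colourMode hU hcne hc hc' hζ (fun μ y => ladder_gauge_shift h₀ h₁ μ y) φ

end Ladder

end Summit.QuantumFields.YangMills.Cruxes.IRcof.TwistedSlab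

end
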